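import Literature.MathematicalPhysics.QuantumFieldTheory.BalabanImbrieJaffe1984to88.BIJ88RestrictedInteraction308
import Mathlib.Probability.Distributions.Gaussian.Multivariate
import Mathlib.Probability.Distributions.Gaussian.HasGaussianLaw.Basic

/-!
# `BalabanImbrieJaffe1984to88.BIJ88ZtPositivity308` — T. Bałaban, J. Imbrie, A. Jaffe, *Effective action and cluster properties of
the abelian Higgs model*, Commun. Math. Phys. **114** (1988) 257–315 [BalabanImbrieJaffe1988]: Sect. 5.14, p. 308 [PDF 52], verbatim
(page render `lit-balaban-r16/renders/cmp114/original-p052-x2.png` read as an image): *"Define z_t(Λ₁₂^{(k)}) for t ∈ [0,1] by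
replacing Ṽ(Λ₁₂^{(k)}) with tṼ(Λ₁₂^{(k)}), replacing χ(cp(e_k), (I−Q^{s*}Q)A^{(k)}) with χ(cp(te_k), (I−Q^{s*}Q)A^{(k)}), and similarly
for χ(cp(e_k), φ^{(k)}). Thus the restrictions and the interactions disappear at t = 0, at which point we have a purely Gaussian
expectation."* and *"Here ⟨·⟩_t is the interacting expectation ⟨·⟩_t = (1/z_t(Λ₁₂^{(k)})) ⟨· χ′_{Λ₁₂^{(k)},t} e^{−tṼ₁₂^{(k)}(Λ^{(k)})}⟩_{1,Λ₁₂^{(k)}},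
with χ′_{Λ₁₂^{(k)},t} defined as above replacing p(e_k) with p(te_k)."* — the display DIVIDES BY `z_t`: this file proves
**`z_t > 0` on the whole branch `0 < t`, `te_k ≤ e^{−1}`** for the restricted interacting family `z(t) = ∫ χ′_{Λ,t}·e^{−tW} dP` of
`BIJ88RestrictedInteraction308` (both interpolations), so that `⟨·⟩_t` and `log z_t` of (5.14.1)–(5.14.2) are well defined and the
standing hypothesis `hz : z_t ≠ 0 on (0,1]` of `BIJ88PerturbativeRemainder308` is DISCHARGED (sequel file `BIJ88EffectiveAction308`).

statement-level skeleton of published theorems with citation tags; proofs where landed; nothing here is a claim about the Yang–Mills mass gap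

WHAT THIS FILE ADDS (theorems only; no definitions, no `Prop` facts; axioms standard).
* §1 *"a purely Gaussian expectation"* — the measure-theoretic input, at Mathlib generality: **a jointly Gaussian finite family of real
  random variables (Mathlib `HasGaussianLaw` of the vector `ω ↦ (X_i(ω))_i`) charges every open set of `ℝ^κ` containing its mean
  vector** (`measure_preimage_pos_of_hasGaussianLaw`), in particular every centered box `{∀ i, |X_i| < r}`, `r > 0`
  (`measure_smallBall_pos_of_hasGaussianLaw`).  Route: the joint law IS Mathlib's `multivariateGaussian (mean) (covariance matrix)`
  (`map_toLp_eq_multivariateGaussian`, by `IsGaussian.ext` + `covarianceBilin_apply_pi`), a push-forward of `stdGaussian`, itself the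
  push-forward of the product of standard real Gaussians, which is positive on nonempty open sets (`volume ≪ gaussianReal 0 1`).
  Marginal Gaussianity alone would NOT suffice (two standard Gaussians `X` and `f(X)` with `f` a measure-preserving rearrangement can
  have disjoint small-field events), hence the JOINT hypothesis.
* §2 **the lower bound `e^{−tK}·P(∀ b ∈ Λ, |Φ_b| < (9/10)c₀) ≤ z_t`** for a non-negative profile `χ(1,·) ≥ 0` ((5.2.3) does not print
  the sign condition; every profile used in print — and the tree's witness `BIJ88CutoffProfileWitness.gevreyCutoff` — is a
  `[0,1]`-valued plateau function, and the partition of unity (5.2.1) with `χ^c = 1 − χ` presupposes it), thresholds `c_b ≥ c₀ > 0`,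
  `p ≥ 0`, measurable `|W| ≤ K`, ANY finite measure, `0 < t`, `te_k ≤ e^{−1}` (so `p(te_k) ≥ 1` and every χ-factor equals `1` on the
  small-field box, (5.2.4)): `exp_mul_measureReal_smallBall_le_integral`; hence **`z_t > 0`** as soon as the small-field box has positive
  probability (`integral_restrictedInteraction_pos_of_smallBall`) — in particular for CENTERED JOINTLY GAUSSIAN fields
  (`integral_restrictedInteraction_pos`, `…_ne_zero_Ioc`: the `hz` hypothesis of `BIJ88PerturbativeRemainder308` for `e_k ≤ e^{−1}`).

PDF held: `paper:balaban1988-cmp114-bij-abelian-higgs-effective-action` (journal page = PDF page + 256); p. 308 [PDF 52].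

CITATION HEADER (lean-in-tree rule).  Part of the lit-balaban TYPED SKELETON (HOME `run/shared/lean/pub/lit-balaban/`), Phase 2,
seat p36 (gen 8, unit `lit-balaban-p36`); row **C2.Eq5.14.1-5.14.2** of `HOME/lit-balaban-r16/ROWS-C2-part2.md` (owner r16; typed leaves
`Eq5141`/`Eq5142` untouched).
-/

namespace Literature.MathematicalPhysics.QuantumFieldTheory.BalabanImbrieJaffe1984to88.BIJ88ZtPositivity308

open MeasureTheory MeasureTheory.Measure ProbabilityTheory Filter Set WithLp Matrix
open BIJ88Sect2Statements (pLog)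
open BIJ88Sect5Statements (CutoffProfile cutoff)
open scoped ENNReal

/-! ## §1 A jointly Gaussian finite family charges every open set containing its mean -/

section Gaussian

/-- The non-degenerate real Gaussian charges every nonempty open set (`volume ≪ gaussianReal 0 1`) — the one-dimensional input of
*"a purely Gaussian expectation"*. [cite: BalabanImbrieJaffe1988, (5.14.2) p.308] -/
theorem isOpenPosMeasure_gaussianReal : IsOpenPosMeasure (gaussianReal 0 1) :=
  (gaussianReal_absolutelyContinuous' 0 one_ne_zero).isOpenPosMeasure

variable {κ : Type*} [Fintype κ]

/-- The standard Gaussian on `EuclideanSpace ℝ κ` (push-forward of the product of standard real Gaussians, Mathlib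
`map_pi_eq_stdGaussian`) gives positive mass to every nonempty open set. [cite: BalabanImbrieJaffe1988, (5.14.2) p.308] -/
theorem stdGaussian_pos_of_isOpen {U : Set (EuclideanSpace ℝ κ)} (hU : IsOpen U) (hne : U.Nonempty) :
    0 < stdGaussian (EuclideanSpace ℝ κ) U := by
  haveI : ∀ _i : κ, IsOpenPosMeasure (gaussianReal 0 1) := fun _ => isOpenPosMeasure_gaussianReal
  rw [← map_pi_eq_stdGaussian, Measure.map_apply (WithLp.measurable_toLp 2 _) hU.measurableSet]
  refine (hU.preimage (PiLp.continuous_toLp 2 _)).measure_pos (Measure.pi fun _ : κ => gaussianReal 0 1) ?_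
  obtain ⟨x, hx⟩ := hne
  exact ⟨WithLp.ofLp x, by simpa using hx⟩

variable [DecidableEq κ]

/-- A multivariate Gaussian (Mathlib `multivariateGaussian m S`, any covariance matrix `S`, degenerate or not) gives positive mass to every
open set containing its mean `m`. [cite: BalabanImbrieJaffe1988, (5.14.2) p.308] -/
theorem multivariateGaussian_pos_of_isOpen (m : EuclideanSpace ℝ κ) (S : Matrix κ κ ℝ)
    {U : Set (EuclideanSpace ℝ κ)} (hU : IsOpen U) (hm : m ∈ U) : 0 < multivariateGaussian m S U := by
  rw [multivariateGaussian, Measure.map_apply (by fun_prop) hU.measurableSet]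
  refine stdGaussian_pos_of_isOpen (hU.preimage (by fun_prop)) ⟨0, ?_⟩
  simpa using hm

variable {Ω : Type*} [MeasurableSpace Ω]

/-- **A jointly Gaussian finite family IS the multivariate Gaussian of its mean vector and covariance matrix**: for measurable
`X_i : Ω → ℝ`, `i ∈ κ` finite, with `HasGaussianLaw (ω ↦ (X_i ω)_i) P`, the law of `ω ↦ (X_i ω)_i ∈ EuclideanSpace ℝ κ` is
`multivariateGaussian (P[X_i])_i (cov[X_i, X_j])_{ij}` (Mathlib `IsGaussian.ext`, `covarianceBilin_apply_pi`).
[cite: BalabanImbrieJaffe1988, (5.14.2) p.308] -/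
theorem map_toLp_eq_multivariateGaussian (P : Measure Ω) [IsProbabilityMeasure P] {X : κ → Ω → ℝ}
    (hX : HasGaussianLaw (fun ω => (X · ω)) P) :
    P.map (fun ω => toLp 2 (X · ω)) =
      multivariateGaussian (toLp 2 fun i => P[X i]) (Matrix.of fun i j => cov[X i, X j; P]) := by
  have hG : HasGaussianLaw (fun ω => toLp 2 (X · ω)) P := hX.toLp_pi 2
  haveI : IsGaussian (P.map (fun ω => toLp 2 (X · ω))) := hG.isGaussian_map
  have hL2 : ∀ i, MemLp (X i) 2 P := fun i => (hX.eval i).memLp_two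
  set S : Matrix κ κ ℝ := Matrix.of fun i j => cov[X i, X j; P] with hSdef
  -- the covariance form of the joint law is `x ⬝ᵥ S *ᵥ y`
  have hcov : ∀ x y : EuclideanSpace ℝ κ,
      covarianceBilin (P.map (fun ω => toLp 2 (X · ω))) x y = x.ofLp ⬝ᵥ S *ᵥ y.ofLp := by
    intro x y
    rw [covarianceBilin_apply_pi hL2]
    simp only [hSdef, dotProduct, Matrix.mulVec, Matrix.of_apply, Finset.mul_sum]
    refine Finset.sum_congr rfl fun i _ => Finset.sum_congr rfl fun j _ => ?_
    ring
  have hS : S.PosSemidef := by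
    refine Matrix.PosSemidef.of_dotProduct_mulVec_nonneg (Matrix.IsHermitian.ext fun i j => ?_) fun x => ?_
    · simp only [hSdef, Matrix.of_apply, star_trivial]
      exact covariance_comm _ _
    · have h := hcov (toLp 2 x) (toLp 2 x)
      rw [star_trivial]
      calc (0 : ℝ) ≤ covarianceBilin (P.map (fun ω => toLp 2 (X · ω))) (toLp 2 x) (toLp 2 x) :=
            covarianceBilin_self_nonneg _
        _ = x ⬝ᵥ S *ᵥ x := by simpa using h
  apply IsGaussian.ext
  · rw [integral_id_multivariateGaussian', integral_map hG.aemeasurable aestronglyMeasurable_id]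
    simp only [id_eq]
    have hint : Integrable (fun ω => toLp 2 (X · ω) : Ω → EuclideanSpace ℝ κ) P := hG.integrable
    ext i
    have h := ContinuousLinearMap.integral_comp_comm (PiLp.proj (𝕜 := ℝ) 2 (fun _ : κ => ℝ) i) hint
    simp only [PiLp.proj_apply] at h
    simp [← h]
  · ext x y
    rw [hcov, covarianceBilin_multivariateGaussian hS]

/-- **A jointly Gaussian finite family charges every open set containing its mean vector**: `0 < P((X_i)_i ∈ U)` for `U ⊆ ℝ^κ` open
with `(P[X_i])_i ∈ U`. [cite: BalabanImbrieJaffe1988, (5.14.2) p.308] -/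
theorem measure_preimage_pos_of_hasGaussianLaw (P : Measure Ω) [IsProbabilityMeasure P] {X : κ → Ω → ℝ}
    (hX : HasGaussianLaw (fun ω => (X · ω)) P) (hmeas : ∀ i, Measurable (X i)) {U : Set (κ → ℝ)} (hU : IsOpen U)
    (hm : (fun i => P[X i]) ∈ U) : 0 < P ((fun ω => (X · ω)) ⁻¹' U) := by
  have hT : Measurable (fun ω => toLp 2 (X · ω) : Ω → EuclideanSpace ℝ κ) := by fun_prop
  have hU' : IsOpen ((WithLp.ofLp : EuclideanSpace ℝ κ → (κ → ℝ)) ⁻¹' U) := hU.preimage (PiLp.continuous_ofLp 2 _)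
  have hset : (fun ω => (X · ω)) ⁻¹' U =
      (fun ω => toLp 2 (X · ω)) ⁻¹' ((WithLp.ofLp : EuclideanSpace ℝ κ → (κ → ℝ)) ⁻¹' U) := by
    ext ω; simp
  rw [hset, ← Measure.map_apply hT hU'.measurableSet, map_toLp_eq_multivariateGaussian P hX]
  exact multivariateGaussian_pos_of_isOpen _ _ hU' (by simpa using hm)

omit [DecidableEq κ] in
/-- **Centered small-field boxes have positive Gaussian probability**: `0 < P(∀ i, |X_i| < r)` for a CENTERED jointly Gaussian finite
family and every `r > 0` — the small-field region is never a null event of the *"purely Gaussian expectation"*.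
[cite: BalabanImbrieJaffe1988, (5.14.2) p.308] -/
theorem measure_smallBall_pos_of_hasGaussianLaw (P : Measure Ω) [IsProbabilityMeasure P] {X : κ → Ω → ℝ}
    (hX : HasGaussianLaw (fun ω => (X · ω)) P) (hmeas : ∀ i, Measurable (X i)) (h0 : ∀ i, P[X i] = 0) {r : ℝ}
    (hr : 0 < r) : 0 < P {ω | ∀ i, |X i ω| < r} := by
  classical
  have hU : IsOpen {x : κ → ℝ | ∀ i, |x i| < r} := by
    rw [show {x : κ → ℝ | ∀ i, |x i| < r} = ⋂ i, {x | |x i| < r} by ext; simp]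
    exact isOpen_iInter_of_finite fun i => isOpen_lt (continuous_abs.comp (continuous_apply i)) continuous_const
  have h := measure_preimage_pos_of_hasGaussianLaw P hX hmeas hU
    (show (fun i => P[X i]) ∈ {x : κ → ℝ | ∀ i, |x i| < r} from fun i => by simp [h0, hr])
  simpa using h

end Gaussian

/-! ## §2 `z_t > 0`: the interacting expectation `⟨·⟩_t = (1/z_t)⟨· χ′_{Λ,t} e^{−tṼ}⟩` is well defined -/

section Positivity

variable (χ : CutoffProfile) {ι Ω : Type*} [MeasurableSpace Ω]

/-- `p(te_k) ≥ 1` on the branch `0 < t`, `te_k ≤ e^{−1}` (`p ≥ 0`). [cite: BalabanImbrieJaffe1988, (2.33) p.263] -/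
theorem one_le_pLog_branch {p ek t : ℝ} (hp : 0 ≤ p) (hek : 0 < ek) (ht : 0 < t) (h1 : t * ek ≤ Real.exp (-1)) :
    1 ≤ pLog p (t * ek) := by
  unfold pLog
  have htek : 0 < t * ek := mul_pos ht hek
  have hlog : Real.log (t * ek) ≤ -1 := by
    have := Real.log_le_log htek h1
    rwa [Real.log_exp] at this
  have h2 : 1 ≤ |Real.log (t * ek)⁻¹| := by
    rw [Real.log_inv]
    exact le_trans (by linarith) (le_abs_self _)
  exact Real.one_le_rpow h2 hp

/-- For `t ∈ (0,1]` and `e_k ≤ e^{−1}` the branch condition `te_k ≤ e^{−1}` holds. [cite: BalabanImbrieJaffe1988, (5.14.2) p.308] -/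
theorem mul_le_exp_neg_one_of_Ioc {ek t : ℝ} (hek : 0 < ek) (hek1 : ek ≤ Real.exp (-1)) (ht : t ∈ Set.Ioc (0 : ℝ) 1) :
    t * ek ≤ Real.exp (-1) :=
  (mul_le_of_le_one_left hek.le ht.2).trans hek1

/-- The small-field box `{∀ b ∈ Λ, |Φ_b| < r}` is a measurable event for measurable fields. [cite: BalabanImbrieJaffe1988, (5.14.2) p.308] -/
theorem measurableSet_smallBall (B : Finset ι) {Φ : ι → Ω → ℝ} (hΦ : ∀ b ∈ B, Measurable (Φ b)) (r : ℝ) :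
    MeasurableSet {ω | ∀ b ∈ B, |Φ b ω| < r} := by
  have h : {ω | ∀ b ∈ B, |Φ b ω| < r} = ⋂ b ∈ B, {ω | |Φ b ω| < r} := by ext; simp
  rw [h]
  exact Finset.measurableSet_biInter B fun b hb =>
    measurableSet_lt (continuous_abs.measurable.comp (hΦ b hb)) measurable_const

/-- The restricted interacting integrand is integrable against any finite measure (`|χ′_{Λ,t}e^{−tW}| ≤ e^{tK}`, `0 ≤ t`).
[cite: BalabanImbrieJaffe1988, (5.14.2) p.308] -/
theorem integrable_restrictedInteraction (p : ℝ) (μ : Measure Ω) [IsFiniteMeasure μ] (B : Finset ι) {Φ : ι → Ω → ℝ}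
    (hΦ : ∀ b ∈ B, Measurable (Φ b)) (c : ι → ℝ) {W : Ω → ℝ} (hW : Measurable W) {K : ℝ} (hK : ∀ ω, |W ω| ≤ K)
    (ek : ℝ) {t : ℝ} (ht : 0 ≤ t) :
    Integrable (fun ω => (∏ b ∈ B, cutoff χ (c b * pLog p (t * ek)) (Φ b ω)) * Real.exp (-(t * W ω))) μ := by
  refine (integrable_const (Real.exp (t * K))).mono'
    (BIJ88RestrictedInteraction308.measurable_restrictedInteraction χ p B hΦ c hW ek t).aestronglyMeasurable
    (Filter.Eventually.of_forall fun ω => ?_)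
  rw [Real.norm_eq_abs]
  exact BIJ88RestrictedInteraction308.abs_restrictedInteraction_le χ p B _ c (hK ω) ht

/-- **The small-field lower bound for `z_t`.**  For a NON-NEGATIVE profile `χ(1,·) ≥ 0`, `p ≥ 0`, thresholds `c_b ≥ c₀ > 0`, measurable
fields, measurable `|W| ≤ K`, ANY finite measure `μ`, and `0 < t`, `te_k ≤ e^{−1}`: on the box `{∀ b ∈ Λ, |Φ_b| < (9/10)c₀}` every factor
`χ(c_b p(te_k), Φ_b)` equals `1` ((5.2.4): `p(te_k) ≥ 1`) and `e^{−tW} ≥ e^{−tK}`; off the box the integrand is `≥ 0`.  Hence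
`e^{−tK}·μ(∀ b ∈ Λ, |Φ_b| < (9/10)c₀) ≤ z_t = ∫ χ′_{Λ,t} e^{−tW} dμ`. [cite: BalabanImbrieJaffe1988, (5.14.2) p.308] -/
theorem exp_mul_measureReal_smallBall_le_integral (hχ : ∀ x, 0 ≤ χ.χ₁ x) {p : ℝ} (hp : 0 ≤ p) (μ : Measure Ω)
    [IsFiniteMeasure μ] (B : Finset ι) {Φ : ι → Ω → ℝ} (hΦ : ∀ b ∈ B, Measurable (Φ b)) {c : ι → ℝ} {c₀ : ℝ} (hc₀ : 0 < c₀)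
    (hcb : ∀ b ∈ B, c₀ ≤ c b) {W : Ω → ℝ} (hW : Measurable W) {K : ℝ} (hK : ∀ ω, |W ω| ≤ K) {ek : ℝ} (hek : 0 < ek)
    {t : ℝ} (ht : 0 < t) (h1 : t * ek ≤ Real.exp (-1)) :
    Real.exp (-(t * K)) * μ.real {ω | ∀ b ∈ B, |Φ b ω| < 9 / 10 * c₀} ≤
      ∫ ω, (∏ b ∈ B, cutoff χ (c b * pLog p (t * ek)) (Φ b ω)) * Real.exp (-(t * W ω)) ∂μ := by
  set E : Set Ω := {ω | ∀ b ∈ B, |Φ b ω| < 9 / 10 * c₀} with hE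
  have hEm : MeasurableSet E := measurableSet_smallBall B hΦ _
  have hpl : 1 ≤ pLog p (t * ek) := one_le_pLog_branch hp hek ht h1
  have hpt : ∀ ω, E.indicator (fun _ => Real.exp (-(t * K))) ω ≤
      (∏ b ∈ B, cutoff χ (c b * pLog p (t * ek)) (Φ b ω)) * Real.exp (-(t * W ω)) := by
    intro ω
    by_cases hω : ω ∈ E
    · rw [Set.indicator_of_mem hω]
      have hprod : (∏ b ∈ B, cutoff χ (c b * pLog p (t * ek)) (Φ b ω)) = 1 := by
        refine Finset.prod_eq_one fun b hb => ?_
        have hcb' : c₀ ≤ c b := hcb b hb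
        have hq : c₀ ≤ c b * pLog p (t * ek) := by
          calc c₀ = c₀ * 1 := (mul_one _).symm
            _ ≤ c b * pLog p (t * ek) := mul_le_mul hcb' hpl zero_le_one (hc₀.le.trans hcb')
        refine BIJ88Sect5Statements.cutoff_eq_one χ (hc₀.trans_le hq) ?_
        have hωb : |Φ b ω| < 9 / 10 * c₀ := hω b hb
        nlinarith
      rw [hprod, one_mul]
      refine Real.exp_le_exp.mpr ?_
      have hWK : W ω ≤ K := (le_abs_self (W ω)).trans (hK ω)
      nlinarith
    · rw [Set.indicator_of_notMem hω]
      refine mul_nonneg (Finset.prod_nonneg fun b _ => ?_) (Real.exp_pos _).le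
      unfold cutoff
      exact hχ _
  calc Real.exp (-(t * K)) * μ.real E = ∫ ω, E.indicator (fun _ => Real.exp (-(t * K))) ω ∂μ := by
        rw [integral_indicator_const _ hEm, smul_eq_mul, mul_comm]
    _ ≤ ∫ ω, (∏ b ∈ B, cutoff χ (c b * pLog p (t * ek)) (Φ b ω)) * Real.exp (-(t * W ω)) ∂μ :=
        integral_mono ((integrable_const _).indicator hEm)
          (integrable_restrictedInteraction χ p μ B hΦ c hW hK ek ht.le) hpt

/-- **`z_t > 0` whenever the small-field box is not a null event** (`χ ≥ 0`, hypotheses as above): the law-agnostic form.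
[cite: BalabanImbrieJaffe1988, (5.14.2) p.308] -/
theorem integral_restrictedInteraction_pos_of_smallBall (hχ : ∀ x, 0 ≤ χ.χ₁ x) {p : ℝ} (hp : 0 ≤ p) (μ : Measure Ω)
    [IsFiniteMeasure μ] (B : Finset ι) {Φ : ι → Ω → ℝ} (hΦ : ∀ b ∈ B, Measurable (Φ b)) {c : ι → ℝ} {c₀ : ℝ} (hc₀ : 0 < c₀)
    (hcb : ∀ b ∈ B, c₀ ≤ c b) {W : Ω → ℝ} (hW : Measurable W) {K : ℝ} (hK : ∀ ω, |W ω| ≤ K) {ek : ℝ} (hek : 0 < ek)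
    (hE : 0 < μ.real {ω | ∀ b ∈ B, |Φ b ω| < 9 / 10 * c₀}) {t : ℝ} (ht : 0 < t) (h1 : t * ek ≤ Real.exp (-1)) :
    0 < ∫ ω, (∏ b ∈ B, cutoff χ (c b * pLog p (t * ek)) (Φ b ω)) * Real.exp (-(t * W ω)) ∂μ :=
  lt_of_lt_of_le (mul_pos (Real.exp_pos _) hE)
    (exp_mul_measureReal_smallBall_le_integral χ hχ hp μ B hΦ hc₀ hcb hW hK hek ht h1)

/-- **The small-field box of a centered jointly Gaussian family of fields has positive probability** (`Φ_b`, `b ∈ Λ`, jointly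
Gaussian under `P` — Mathlib `HasGaussianLaw` of `ω ↦ (Φ_b ω)_{b∈Λ}` — and centered). [cite: BalabanImbrieJaffe1988, (5.14.2) p.308] -/
theorem measureReal_smallBall_pos_of_hasGaussianLaw (P : Measure Ω) [IsProbabilityMeasure P] (B : Finset ι) {Φ : ι → Ω → ℝ}
    (hJ : HasGaussianLaw (fun ω (b : B) => Φ b ω) P) (hΦ : ∀ b ∈ B, Measurable (Φ b)) (h0 : ∀ b ∈ B, P[Φ b] = 0) {r : ℝ}
    (hr : 0 < r) : 0 < P.real {ω | ∀ b ∈ B, |Φ b ω| < r} := by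
  have h := measure_smallBall_pos_of_hasGaussianLaw P (X := fun (b : B) ω => Φ b ω) hJ (fun b => hΦ b b.2)
    (fun b => h0 b b.2) hr
  have hset : {ω | ∀ b ∈ B, |Φ b ω| < r} = {ω | ∀ i : B, |Φ i ω| < r} := by
    ext ω
    simp only [Set.mem_setOf_eq, Subtype.forall]
  rw [hset]
  exact ENNReal.toReal_pos h.ne' (measure_ne_top P _)

/-- **`z_t > 0` on the whole branch for centered jointly Gaussian fields** (`χ ≥ 0`, `p ≥ 0`, `c_b ≥ c₀ > 0`, measurable `|W| ≤ K`,
`0 < t`, `te_k ≤ e^{−1}`): the interacting expectation `⟨·⟩_t = (1/z_t)⟨· χ′_{Λ,t}e^{−tṼ}⟩` of p. 308 is well defined.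
[cite: BalabanImbrieJaffe1988, (5.14.2) p.308] -/
theorem integral_restrictedInteraction_pos (hχ : ∀ x, 0 ≤ χ.χ₁ x) {p : ℝ} (hp : 0 ≤ p) (P : Measure Ω) [IsProbabilityMeasure P]
    (B : Finset ι) {Φ : ι → Ω → ℝ} (hJ : HasGaussianLaw (fun ω (b : B) => Φ b ω) P) (hΦ : ∀ b ∈ B, Measurable (Φ b))
    (h0 : ∀ b ∈ B, P[Φ b] = 0) {c : ι → ℝ} {c₀ : ℝ} (hc₀ : 0 < c₀) (hcb : ∀ b ∈ B, c₀ ≤ c b) {W : Ω → ℝ} (hW : Measurable W)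
    {K : ℝ} (hK : ∀ ω, |W ω| ≤ K) {ek : ℝ} (hek : 0 < ek) {t : ℝ} (ht : 0 < t) (h1 : t * ek ≤ Real.exp (-1)) :
    0 < ∫ ω, (∏ b ∈ B, cutoff χ (c b * pLog p (t * ek)) (Φ b ω)) * Real.exp (-(t * W ω)) ∂P :=
  integral_restrictedInteraction_pos_of_smallBall χ hχ hp P B hΦ hc₀ hcb hW hK hek
    (measureReal_smallBall_pos_of_hasGaussianLaw P B hJ hΦ h0 (by linarith)) ht h1

/-- **The hypothesis `hz` of `BIJ88PerturbativeRemainder308` DISCHARGED**: for `e_k ≤ e^{−1}` and centered jointly Gaussian fields,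
`z_t ≠ 0` for every `t ∈ (0,1]`. [cite: BalabanImbrieJaffe1988, (5.14.2) p.308] -/
theorem integral_restrictedInteraction_ne_zero_Ioc (hχ : ∀ x, 0 ≤ χ.χ₁ x) {p : ℝ} (hp : 0 ≤ p) (P : Measure Ω)
    [IsProbabilityMeasure P] (B : Finset ι) {Φ : ι → Ω → ℝ} (hJ : HasGaussianLaw (fun ω (b : B) => Φ b ω) P)
    (hΦ : ∀ b ∈ B, Measurable (Φ b)) (h0 : ∀ b ∈ B, P[Φ b] = 0) {c : ι → ℝ} {c₀ : ℝ} (hc₀ : 0 < c₀) (hcb : ∀ b ∈ B, c₀ ≤ c b)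
    {W : Ω → ℝ} (hW : Measurable W) {K : ℝ} (hK : ∀ ω, |W ω| ≤ K) {ek : ℝ} (hek : 0 < ek) (hek1 : ek ≤ Real.exp (-1)) :
    ∀ t ∈ Set.Ioc (0 : ℝ) 1, (∫ ω, (∏ b ∈ B, cutoff χ (c b * pLog p (t * ek)) (Φ b ω)) * Real.exp (-(t * W ω)) ∂P) ≠ 0 :=
  fun _t ht => (integral_restrictedInteraction_pos χ hχ hp P B hJ hΦ h0 hc₀ hcb hW hK hek ht.1
    (mul_le_exp_neg_one_of_Ioc hek hek1 ht)).ne'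

/-- The marginals of a jointly Gaussian family of fields are Gaussian (Mathlib `HasGaussianLaw.eval`): the hypothesis `hG` of the
`BIJ88GaussianMoments308` / `BIJ88PerturbativeRemainder308` theorems follows from the joint one. [cite: BalabanImbrieJaffe1988, (5.14.2) p.308] -/
theorem hasGaussianLaw_of_joint (P : Measure Ω) (B : Finset ι) {Φ : ι → Ω → ℝ}
    (hJ : HasGaussianLaw (fun ω (b : B) => Φ b ω) P) : ∀ b ∈ B, HasGaussianLaw (Φ b) P :=
  fun b hb => hJ.eval ⟨b, hb⟩

end Positivity

end Literature.MathematicalPhysics.QuantumFieldTheory.BalabanImbrieJaffe1984to88.BIJ88ZtPositivity308
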